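import Literature.MathematicalPhysics.KineticTheory.LambertianRedrawNondegenerate
import Literature.MathematicalPhysics.KineticTheory.HardSphereEuler
import Literature.Analysis.FluidPDE.HardSphereAlexander
import Summits.AtomisticToContinuum.HydrodynamicLimit.Theorems.LambertianContactSwapLambertianWellPosedRegular
import HarnessLib

/-!
# GST iteration for the Lambertian hard-sphere flow, I: survivors and their regularity
# (`LambertianContactSwap.LambertianEuler`, stmt-AtomisticToContinuum-11854, line `Sketch`;
# sub-goal `iterateLambda_bad_null` of the stub `stub_iterateLambda`)

The iteration of the deterministic Alexander / Gallagher–Saint-Raymond–Texier argument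
(`Literature.Analysis.FluidPDE.HardSphereAlexander`: `iterGood`, `volume_iterGood_inter_preimage_le`)
transcribed to the Lambertian flow `Λ_t(z; ξs) = lambertFlow G ε ξs z t` with fresh noise at each
window. The survivors `iterGoodL k ⊆ Config × (ℕ → V3)` are the pairs (datum, noise) of the shell
`E ≤ V²/2` with short-time good datum, short-time good images at the checkpoints `δ, 2δ, …, kδ`, and
collision instants passing each checkpoint. Here: the cocycle of `Λ` over the noise shift (restart
kit `LRestart.*`), measurability, the identification of the noise-section of `iterGoodL (k+1)` with
the checkpoint event of the restricted strong Markov property (hypothesis MARKOV of the stub), the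
fresh-tail transfer on the survivors (`lintegral_iterGoodL_succ_fresh`) and their a.e. regularity
over the next window (`iterateLambda_bad_null`) from clause 2 of the hypothesis WINDOW.
-/

noncomputable section

open scoped BigOperators Topology ENNReal InnerProductSpace
open MeasureTheory ProbabilityTheory Filter Set
open Literature.MathematicalPhysics.KineticTheory
open Literature.Analysis.FluidPDE Literature.Analysis.FluidPDE.Alexander

namespace Summit.AtomisticToContinuum.HydrodynamicLimit.Theorems.LambertianContactSwapLambertianEulerIterateGood

/-! ## Restart: instants beyond a checkpoint and the cocycle of the flow over the noise shift -/

section Restart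

variable {d : Type*} [Fintype d] {X : Type*} {N : ℕ} {G : Geometry d X} {ε : ℝ}
  {ξs : ℕ → EuclideanSpace ℝ d} {z : Config N d X} {s u : ℝ} {k : ℕ}

/-- Non-accumulation transfers to the restarted recursion: if `s` lies in the `k`-th collision
segment of `(z, ξs)` and some instant of `(z, ξs)` exceeds `s + u`, then some instant of the recursion
restarted at `Λ_s(z; ξs)` with the shifted noise `ξs (· + k)` exceeds `u`. [folklore] -/
theorem exists_lt_instant_restart (hs : 0 ≤ s) (hu : 0 ≤ u)
    (h1 : lambertInstant G ε ξs z k ≤ ENNReal.ofReal s)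
    (h2 : ENNReal.ofReal s < lambertInstant G ε ξs z (k + 1))
    (h3 : ∃ k', ENNReal.ofReal (s + u) < lambertInstant G ε ξs z k') :
    ∃ m, ENNReal.ofReal u < lambertInstant G ε (fun n => ξs (n + k)) (lambertFlow G ε ξs z s) m := by
  obtain ⟨k', hk'⟩ := h3
  have hlt : ENNReal.ofReal u + ENNReal.ofReal s <
      lambertInstant G ε (fun n => ξs (n + k)) (lambertFlow G ε ξs z s) (k' + 1) + ENNReal.ofReal s := by
    rw [LRestart.lambertInstant_lambertFlow_succ_add hs h1 h2 k', ← ENNReal.ofReal_add hu hs, add_comm u s]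
    exact hk'.trans_le (monotone_lambertInstant _ _ (by omega))
  exact ⟨k' + 1, (ENNReal.add_lt_add_iff_right ENNReal.ofReal_ne_top).1 hlt⟩

/-- Conversely, non-accumulation of the restarted recursion before `u` gives non-accumulation of
`(z, ξs)` before `s + u`. [folklore] -/
theorem exists_lt_instant_of_restart (hs : 0 ≤ s) (hu : 0 ≤ u)
    (h1 : lambertInstant G ε ξs z k ≤ ENNReal.ofReal s)
    (h2 : ENNReal.ofReal s < lambertInstant G ε ξs z (k + 1))
    (h3 : ∃ m, ENNReal.ofReal u < lambertInstant G ε (fun n => ξs (n + k)) (lambertFlow G ε ξs z s) m) :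
    ∃ k', ENNReal.ofReal (s + u) < lambertInstant G ε ξs z k' := by
  obtain ⟨m, hm⟩ := h3
  have hm0 : m ≠ 0 := by
    rintro rfl
    rw [lambertInstant_zero] at hm
    exact ENNReal.not_lt_zero hm
  obtain ⟨m, rfl⟩ := Nat.exists_eq_add_one_of_ne_zero hm0
  refine ⟨k + (m + 1), ?_⟩
  rw [ENNReal.ofReal_add hs hu, add_comm, ← LRestart.lambertInstant_lambertFlow_succ_add hs h1 h2 m]
  exact ENNReal.add_lt_add_right ENNReal.ofReal_ne_top hm

/-- **Cocycle of the Lambertian flow over the noise shift**, off the accumulation set: if the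
collision instants of `(z, ξs)` pass beyond `s` and beyond `s + u` (`s, u ≥ 0`), then
`Λ_{s+u}(z; ξs) = Λ_u(Λ_s(z; ξs); ξs (· + K_s(z; ξs)))`, `K_s = lambertCount`. [folklore] -/
theorem lambertFlow_add_restart (hs : 0 ≤ s) (hu : 0 ≤ u)
    (hS : ∃ k, ENNReal.ofReal s < lambertInstant G ε ξs z k)
    (hSU : ∃ k, ENNReal.ofReal (s + u) < lambertInstant G ε ξs z k) :
    lambertFlow G ε ξs z (s + u) =
      lambertFlow G ε (fun n => ξs (n + lambertCount G ε ξs z s)) (lambertFlow G ε ξs z s) u := by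
  obtain ⟨k, h1, h2⟩ := LRestart.exists_lambert_segment hS le_rfl
  rw [lambertCount_eq_of_segment h1 h2]
  obtain ⟨m, h1', h2'⟩ :=
    LRestart.exists_lambert_segment (exists_lt_instant_restart hs hu h1 h2 hSU) le_rfl
  exact LRestart.lambertFlow_add_of_segment hs hu h1 h2 h1' h2'

end Restart

/-! ## Two measure-theoretic trivialities -/

/-- Reading a measurable noise sequence from a measurable random index on is again a measurable
sequence (the index takes countably many values). [folklore] -/
theorem measurable_shift {α β : Type*} [MeasurableSpace α] [MeasurableSpace β] {K : α → ℕ}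
    (hK : Measurable K) {ξs : α → ℕ → β} (hξs : Measurable ξs) :
    Measurable fun a => fun m => ξs a (m + K a) := by
  refine measurable_pi_lambda _ fun m => ?_
  have h : (fun a => ξs a (m + K a)) = (fun p : (ℕ → β) × ℕ => p.1 (m + p.2)) ∘ fun a => (ξs a, K a) := rfl
  rw [h]
  exact (measurable_from_prod_countable_left fun k => measurable_pi_apply (m + k)).comp (hξs.prodMk hK)

/-- The indicator of `A ∩ f⁻¹ B` is the indicator of `A` applied to `1_B ∘ f`. [folklore] -/
theorem indicator_inter_preimage_one {α β : Type*} (A : Set α) (B : Set β) (f : α → β) (a : α) :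
    (A ∩ {a | f a ∈ B}).indicator (1 : α → ℝ≥0∞) a = A.indicator (fun a => B.indicator (1 : β → ℝ≥0∞) (f a)) a := by
  by_cases hA : a ∈ A <;> by_cases hB : f a ∈ B <;> simp [hA, hB]

/-! ## The survivors of the iteration -/

section Torus

variable {N : ℕ} {ε r δ V : ℝ}

local notation "G₃" => Torus.geometry (Fin 3)
local notation "γ₃" => lambertNoise (Fin 3)

variable (N ε r δ V) in
/-- The **survivors of `k` windows**: pairs (datum, noise) with datum in the short-time good set and
the energy shell `E ≤ V²/2`, whose Lambertian images at the checkpoint times `(i+1)δ`, `i < k`, are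
short-time good, and whose collision instants pass each checkpoint (the Lambertian copy of
`Alexander.iterGood`). [cite: GST2013, proof of Prop. 4.1.1 p. 19] -/
def iterGoodL (k : ℕ) : Set (Config N (Fin 3) T3 × (ℕ → V3)) :=
  {p | p.1 ∈ shortGood N ε r δ ∧ configEnergy p.1 ≤ V ^ 2 / 2 ∧
    ∀ i : ℕ, i < k → lambertFlow G₃ ε p.2 p.1 (((i : ℝ) + 1) * δ) ∈ shortGood N ε r δ ∧
      ∃ j, ENNReal.ofReal (((i : ℝ) + 1) * δ) < lambertInstant G₃ ε p.2 p.1 j}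

/-- The survivors decrease with the number of windows. [folklore] -/
theorem iterGoodL_succ_subset (k : ℕ) : iterGoodL N ε r δ V (k + 1) ⊆ iterGoodL N ε r δ V k :=
  fun _ hp => ⟨hp.1, hp.2.1, fun i hi => hp.2.2 i (Nat.lt_succ_of_lt hi)⟩

/-- The survivor sets are measurable. [folklore] -/
theorem measurableSet_iterGoodL (hε' : ε < 2⁻¹) (k : ℕ) : MeasurableSet (iterGoodL N ε r δ V k) := by
  have hG := Torus.isHardSphereRegular_geometry (d := Fin 3) hε'
  refine measurableSet_setOf.2 <| ((measurableSet_shortGood ε r δ).mem.comp measurable_fst).and <|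
    (measurableSet_setOf.1 (measurableSet_le (measurable_configEnergy.comp measurable_fst)
      measurable_const)).and <| Measurable.forall fun i => Measurable.imp measurable_const <|
      ((measurableSet_shortGood ε r δ).mem.comp (measurable_lambertFlow_torus hε' _)).and <|
        Measurable.exists fun j => measurableSet_setOf.1 <| measurableSet_lt measurable_const
          (measurable_lambertInstant hG Torus.isMeasurable_geometry j)

/-- **The noise-section of `iterGoodL (k+1)` at a good datum is the checkpoint event** of the
restricted strong Markov property at time `(k+1)δ` with checkpoints `(i+1)δ`, `i ≤ k`, and target
"all checkpoints short-time good". [folklore] -/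
theorem mk_mem_iterGoodL_succ_iff (hδ : 0 ≤ δ) {k : ℕ} {z : Config N (Fin 3) T3}
    (hz : z ∈ shortGood N ε r δ ∧ configEnergy z ≤ V ^ 2 / 2) (ξs : ℕ → V3) :
    (z, ξs) ∈ iterGoodL N ε r δ V (k + 1) ↔
      ξs ∈ {ξs : ℕ → V3 |
        (∃ j, ENNReal.ofReal (((k : ℝ) + 1) * δ) < lambertInstant G₃ ε ξs z j) ∧
        (fun i : Fin (k + 1) => lambertFlow G₃ ε ξs z ((((i : ℕ) : ℝ) + 1) * δ)) ∈
          {c : Fin (k + 1) → Config N (Fin 3) T3 | ∀ i, c i ∈ shortGood N ε r δ}} := by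
  simp only [iterGoodL, mem_setOf_eq]
  constructor
  · rintro ⟨-, -, h⟩
    exact ⟨(h k (Nat.lt_succ_self k)).2, fun i => (h i i.isLt).1⟩
  · rintro ⟨⟨j, hj⟩, h⟩
    refine ⟨hz.1, hz.2, fun i hi => ⟨h ⟨i, hi⟩, j, lt_of_le_of_lt ?_ hj⟩⟩
    refine ENNReal.ofReal_le_ofReal (mul_le_mul_of_nonneg_right ?_ hδ)
    have : (i : ℝ) ≤ k := by exact_mod_cast Nat.lt_succ_iff.1 hi
    linarith

/-! ## The fresh-tail transfer on the survivors -/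

variable
  (hM : ∀ (z : Config N (Fin 3) T3) (s : ℝ), 0 ≤ s →
    ∀ {m : ℕ} (r : Fin m → ℝ), (∀ i, 0 ≤ r i ∧ r i ≤ s) →
    ∀ {Q : Set (Fin m → Config N (Fin 3) T3)}, MeasurableSet Q →
    ∀ {H : Config N (Fin 3) T3 × (ℕ → V3) → ℝ≥0∞}, Measurable H →
      ∫⁻ ξs, {ξs : ℕ → V3 |
          (∃ k, ENNReal.ofReal s < lambertInstant (Torus.geometry (Fin 3)) ε ξs z k) ∧
          (fun i => lambertFlow (Torus.geometry (Fin 3)) ε ξs z (r i)) ∈ Q}.indicator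
          (fun ξs => H (lambertFlow (Torus.geometry (Fin 3)) ε ξs z s,
            fun n => ξs (n + lambertCount (Torus.geometry (Fin 3)) ε ξs z s))) ξs
          ∂(lambertNoise (Fin 3)) =
      ∫⁻ ξs, {ξs : ℕ → V3 |
          (∃ k, ENNReal.ofReal s < lambertInstant (Torus.geometry (Fin 3)) ε ξs z k) ∧
          (fun i => lambertFlow (Torus.geometry (Fin 3)) ε ξs z (r i)) ∈ Q}.indicator
          (fun ξs => ∫⁻ ηs, H (lambertFlow (Torus.geometry (Fin 3)) ε ξs z s, ηs)
            ∂(lambertNoise (Fin 3))) ξs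
          ∂(lambertNoise (Fin 3)))

include hM in
/-- **Fresh-tail transfer on the survivors**: on `iterGoodL (k+1)`, integrating a measurable
functional of (state at time `s = (k+1)δ`, noise not yet used at time `s`) against `vol ⊗ γ^ℕ` is
the same as integrating its average over a fresh noise sequence (Tonelli in the datum, then the
restricted strong Markov property at the checkpoint event, which is the noise-section of
`iterGoodL (k+1)`). [folklore] -/
theorem lintegral_iterGoodL_succ_fresh (hε' : ε < 2⁻¹) (hδ : 0 ≤ δ) (k : ℕ)
    {F : Config N (Fin 3) T3 × (ℕ → V3) → ℝ≥0∞} (hF : Measurable F) :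
    ∫⁻ p, (iterGoodL N ε r δ V (k + 1)).indicator (fun p =>
        F (lambertFlow G₃ ε p.2 p.1 (((k : ℝ) + 1) * δ),
          fun n => p.2 (n + lambertCount G₃ ε p.2 p.1 (((k : ℝ) + 1) * δ)))) p ∂(volume.prod γ₃) =
      ∫⁻ p, (iterGoodL N ε r δ V (k + 1)).indicator (fun p =>
        ∫⁻ ηs, F (lambertFlow G₃ ε p.2 p.1 (((k : ℝ) + 1) * δ), ηs) ∂γ₃) p ∂(volume.prod γ₃) := by
  have hG := Torus.isHardSphereRegular_geometry (d := Fin 3) hε'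
  set s : ℝ := ((k : ℝ) + 1) * δ with hs_def
  have hs : 0 ≤ s := by positivity
  have hΛ := measurable_lambertFlow_torus (d := Fin 3) (N := N) hε' s
  have hL : Measurable fun p : Config N (Fin 3) T3 × (ℕ → V3) =>
      F (lambertFlow G₃ ε p.2 p.1 s, fun n => p.2 (n + lambertCount G₃ ε p.2 p.1 s)) :=
    hF.comp (hΛ.prodMk (measurable_shift (measurable_lambertCount hG Torus.isMeasurable_geometry s)
      measurable_snd))
  have hR : Measurable fun p : Config N (Fin 3) T3 × (ℕ → V3) =>
      ∫⁻ ηs, F (lambertFlow G₃ ε p.2 p.1 s, ηs) ∂γ₃ :=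
    hF.lintegral_prod_right'.comp hΛ
  have hGood := measurableSet_iterGoodL (N := N) (r := r) (δ := δ) (V := V) hε' (k + 1)
  rw [lintegral_prod _ (hL.indicator hGood).aemeasurable,
    lintegral_prod _ (hR.indicator hGood).aemeasurable]
  refine lintegral_congr fun z => ?_
  by_cases hz : z ∈ shortGood N ε r δ ∧ configEnergy z ≤ V ^ 2 / 2
  · have hsec : Prod.mk z ⁻¹' iterGoodL N ε r δ V (k + 1) = {ξs : ℕ → V3 |
        (∃ j, ENNReal.ofReal s < lambertInstant G₃ ε ξs z j) ∧
        (fun i : Fin (k + 1) => lambertFlow G₃ ε ξs z ((((i : ℕ) : ℝ) + 1) * δ)) ∈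
          {c : Fin (k + 1) → Config N (Fin 3) T3 | ∀ i, c i ∈ shortGood N ε r δ}} :=
      Set.ext fun ξs => mk_mem_iterGoodL_succ_iff hδ hz ξs
    have hr : ∀ i : Fin (k + 1), 0 ≤ (((i : ℕ) : ℝ) + 1) * δ ∧ (((i : ℕ) : ℝ) + 1) * δ ≤ s := by
      intro i
      refine ⟨by positivity, mul_le_mul_of_nonneg_right ?_ hδ⟩
      have : ((i : ℕ) : ℝ) ≤ k := by exact_mod_cast Nat.lt_succ_iff.1 i.isLt
      linarith
    have hQ : MeasurableSet {c : Fin (k + 1) → Config N (Fin 3) T3 | ∀ i, c i ∈ shortGood N ε r δ} :=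
      measurableSet_setOf.2 (Measurable.forall fun i =>
        (measurableSet_shortGood ε r δ).mem.comp (measurable_pi_apply i))
    have key := hM z s hs (fun i : Fin (k + 1) => (((i : ℕ) : ℝ) + 1) * δ) hr hQ hF
    rw [← hsec] at key
    simpa only [← Set.indicator_comp_right (Prod.mk z), Function.comp_def] using key
  · have h0 : ∀ (Φ : Config N (Fin 3) T3 × (ℕ → V3) → ℝ≥0∞) (ξs : ℕ → V3),
        (iterGoodL N ε r δ V (k + 1)).indicator Φ (z, ξs) = 0 :=
      fun Φ ξs => Set.indicator_of_notMem (fun h => hz ⟨h.1, h.2.1⟩) Φ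
    simp only [h0]

/-! ## Regularity of the survivors over the next window -/

variable
  (hW2 : ∀ z : Config N (Fin 3) T3, z ∈ shortGood N ε r δ → configEnergy z ≤ V ^ 2 / 2 →
    ∀ᵐ ξs ∂(lambertNoise (Fin 3)),
      (∃ k, ENNReal.ofReal δ < lambertInstant (Torus.geometry (Fin 3)) ε ξs z k) ∧
      lambertFlow (Torus.geometry (Fin 3)) ε ξs z δ ∈ hardSphereDomain (Torus.geometry (Fin 3)) N ε)

/-- The one-window bad set of pairs (datum, noise): the instants do not pass `δ`, or the flow leaves
the domain at time `δ`; it is measurable. [folklore] -/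
theorem measurableSet_windowBad (hε' : ε < 2⁻¹) :
    MeasurableSet {q : Config N (Fin 3) T3 × (ℕ → V3) |
      ¬ (∃ j, ENNReal.ofReal δ < lambertInstant G₃ ε q.2 q.1 j) ∨
        lambertFlow G₃ ε q.2 q.1 δ ∉ hardSphereDomain G₃ N ε} := by
  have hG := Torus.isHardSphereRegular_geometry (d := Fin 3) hε'
  refine measurableSet_setOf.2 <| (Measurable.exists fun j => measurableSet_setOf.1 <|
    measurableSet_lt measurable_const (measurable_lambertInstant hG Torus.isMeasurable_geometry j)).not.or
      ((measurableSet_hardSphereDomain _ Torus.measurable_geometry_sepVec N ε).mem.comp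
        (measurable_lambertFlow_torus hε' δ)).not

include hW2 in
/-- At a good datum, the one-window bad set has a `γ^ℕ`-null noise-section (hypothesis WINDOW,
clause 2), in `lintegral` form. [folklore] -/
theorem lintegral_windowBad_eq_zero {w : Config N (Fin 3) T3} (hw : w ∈ shortGood N ε r δ)
    (hEw : configEnergy w ≤ V ^ 2 / 2) :
    ∫⁻ ηs, {q : Config N (Fin 3) T3 × (ℕ → V3) |
      ¬ (∃ j, ENNReal.ofReal δ < lambertInstant G₃ ε q.2 q.1 j) ∨
        lambertFlow G₃ ε q.2 q.1 δ ∉ hardSphereDomain G₃ N ε}.indicator (1 : Config N (Fin 3) T3 × (ℕ → V3) → ℝ≥0∞) (w, ηs) ∂γ₃ = 0 := by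
  refine (lintegral_congr_ae ((hW2 w hw hEw).mono fun ηs hη => ?_)).trans lintegral_zero
  exact Set.indicator_of_notMem (fun hb => hb.elim (fun h1 => h1 hη.1) fun h2 => h2 hη.2) _

include hM hW2 in
/-- **A.e. regularity of the survivors over the next window** (sub-goal `iterateLambda_bad_null` of
`stub_iterateLambda`, in the notation of this file): on `iterGoodL k`, for `vol ⊗ γ^ℕ`-a.e. pair the
collision instants pass `(k+1)δ` and the flow is in the domain at time `(k+1)δ`. For `k = 0` this is
clause 2 of WINDOW section by section; for `k + 1`, by the cocycle over the noise shift the bad pairs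
are those whose restarted pair `(Λ_s, ξs (· + K_s))`, `s = (k+1)δ`, is one-window bad, and by the
fresh-tail transfer their measure is the integral over the survivors of the `γ^ℕ`-measure of the
one-window bad section at `Λ_s ∈ shortGood ∩ {E ≤ V²/2}`, which vanishes. [cite: GST2013, proof of Prop. 4.1.1 p. 19] -/
theorem measure_iterGoodL_bad_eq_zero (hε' : ε < 2⁻¹) (hδ : 0 ≤ δ) (k : ℕ) :
    (volume.prod γ₃) (iterGoodL N ε r δ V k ∩ {p |
      ¬ (∃ j, ENNReal.ofReal (((k : ℝ) + 1) * δ) < lambertInstant G₃ ε p.2 p.1 j) ∨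
        lambertFlow G₃ ε p.2 p.1 (((k : ℝ) + 1) * δ) ∉ hardSphereDomain G₃ N ε}) = 0 := by
  have hG := Torus.isHardSphereRegular_geometry (d := Fin 3) hε'
  cases k with
  | zero =>
    simp only [Nat.cast_zero, zero_add, one_mul]
    refine Measure.measure_prod_null_of_ae_null
      ((measurableSet_iterGoodL hε' 0).inter (measurableSet_windowBad hε')) (Eventually.of_forall fun z => ?_)
    show γ₃ (Prod.mk z ⁻¹' _) = 0
    by_cases hz : z ∈ shortGood N ε r δ ∧ configEnergy z ≤ V ^ 2 / 2
    · have h := hW2 z hz.1 hz.2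
      rw [ae_iff] at h
      refine measure_mono_null (fun ξs hξ => ?_) h
      exact fun hgood => hξ.2.elim (fun h1 => h1 hgood.1) fun h2 => h2 hgood.2
    · exact measure_mono_null (fun ξs hξ => (hz ⟨hξ.1.1, hξ.1.2.1⟩).elim) measure_empty
  | succ k =>
    set s : ℝ := ((k : ℝ) + 1) * δ with hs_def
    have hs : 0 ≤ s := by positivity
    have hcast : (((k + 1 : ℕ) : ℝ) + 1) * δ = s + δ := by rw [hs_def]; push_cast; ring
    rw [hcast]
    have hΛ := measurable_lambertFlow_torus (d := Fin 3) (N := N) hε' s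
    have hRst : Measurable fun p : Config N (Fin 3) T3 × (ℕ → V3) =>
        (lambertFlow G₃ ε p.2 p.1 s, fun n => p.2 (n + lambertCount G₃ ε p.2 p.1 s)) :=
      hΛ.prodMk (measurable_shift (measurable_lambertCount hG Torus.isMeasurable_geometry s)
        measurable_snd)
    have hGood := measurableSet_iterGoodL (N := N) (r := r) (δ := δ) (V := V) hε' (k + 1)
    have hBad := measurableSet_windowBad (N := N) (ε := ε) (δ := δ) hε'
    -- the bad survivors restart into the one-window bad set
    have hsub : iterGoodL N ε r δ V (k + 1) ∩ {p |
        ¬ (∃ j, ENNReal.ofReal (s + δ) < lambertInstant G₃ ε p.2 p.1 j) ∨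
          lambertFlow G₃ ε p.2 p.1 (s + δ) ∉ hardSphereDomain G₃ N ε} ⊆
        iterGoodL N ε r δ V (k + 1) ∩ {p |
          (lambertFlow G₃ ε p.2 p.1 s, fun n => p.2 (n + lambertCount G₃ ε p.2 p.1 s)) ∈
            {q : Config N (Fin 3) T3 × (ℕ → V3) |
              ¬ (∃ j, ENNReal.ofReal δ < lambertInstant G₃ ε q.2 q.1 j) ∨
                lambertFlow G₃ ε q.2 q.1 δ ∉ hardSphereDomain G₃ N ε}} := by
      rintro ⟨z, ξs⟩ ⟨hg, hb⟩
      refine ⟨hg, ?_⟩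
      have hS : ∃ j, ENNReal.ofReal s < lambertInstant G₃ ε ξs z j := (hg.2.2 k (Nat.lt_succ_self k)).2
      obtain ⟨k', h1, h2⟩ := LRestart.exists_lambert_segment hS le_rfl
      simp only [mem_setOf_eq]
      rw [lambertCount_eq_of_segment h1 h2]
      by_contra hcon
      rw [not_or, not_not, not_not] at hcon
      have hSU := exists_lt_instant_of_restart hs hδ h1 h2 hcon.1
      rcases hb with hb | hb
      · exact hb hSU
      · apply hb
        rw [lambertFlow_add_restart hs hδ hS hSU, lambertCount_eq_of_segment h1 h2]
        exact hcon.2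
    refine measure_mono_null hsub ?_
    calc (volume.prod γ₃) (iterGoodL N ε r δ V (k + 1) ∩ {p |
          (lambertFlow G₃ ε p.2 p.1 s, fun n => p.2 (n + lambertCount G₃ ε p.2 p.1 s)) ∈
            {q : Config N (Fin 3) T3 × (ℕ → V3) |
              ¬ (∃ j, ENNReal.ofReal δ < lambertInstant G₃ ε q.2 q.1 j) ∨
                lambertFlow G₃ ε q.2 q.1 δ ∉ hardSphereDomain G₃ N ε}})
        = ∫⁻ p, (iterGoodL N ε r δ V (k + 1) ∩ {p |
          (lambertFlow G₃ ε p.2 p.1 s, fun n => p.2 (n + lambertCount G₃ ε p.2 p.1 s)) ∈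
            {q : Config N (Fin 3) T3 × (ℕ → V3) |
              ¬ (∃ j, ENNReal.ofReal δ < lambertInstant G₃ ε q.2 q.1 j) ∨
                lambertFlow G₃ ε q.2 q.1 δ ∉ hardSphereDomain G₃ N ε}}).indicator 1 p ∂(volume.prod γ₃) :=
          (lintegral_indicator_one (hGood.inter (hRst hBad))).symm
      _ = ∫⁻ p, (iterGoodL N ε r δ V (k + 1)).indicator (fun p =>
          {q : Config N (Fin 3) T3 × (ℕ → V3) |
              ¬ (∃ j, ENNReal.ofReal δ < lambertInstant G₃ ε q.2 q.1 j) ∨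
                lambertFlow G₃ ε q.2 q.1 δ ∉ hardSphereDomain G₃ N ε}.indicator (1 : Config N (Fin 3) T3 × (ℕ → V3) → ℝ≥0∞)
            (lambertFlow G₃ ε p.2 p.1 s, fun n => p.2 (n + lambertCount G₃ ε p.2 p.1 s))) p
            ∂(volume.prod γ₃) :=
          lintegral_congr fun p => indicator_inter_preimage_one _ _ _ p
      _ = ∫⁻ p, (iterGoodL N ε r δ V (k + 1)).indicator (fun p =>
          ∫⁻ ηs, {q : Config N (Fin 3) T3 × (ℕ → V3) |
              ¬ (∃ j, ENNReal.ofReal δ < lambertInstant G₃ ε q.2 q.1 j) ∨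
                lambertFlow G₃ ε q.2 q.1 δ ∉ hardSphereDomain G₃ N ε}.indicator (1 : Config N (Fin 3) T3 × (ℕ → V3) → ℝ≥0∞)
            (lambertFlow G₃ ε p.2 p.1 s, ηs) ∂γ₃) p ∂(volume.prod γ₃) :=
          lintegral_iterGoodL_succ_fresh hM hε' hδ k (measurable_one.indicator hBad)
      _ = 0 := by
          refine (lintegral_congr fun p => ?_).trans lintegral_zero
          by_cases hp : p ∈ iterGoodL N ε r δ V (k + 1)
          · rw [Set.indicator_of_mem hp]
            exact lintegral_windowBad_eq_zero hW2 (hp.2.2 k (Nat.lt_succ_self k)).1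
              ((configEnergy_lambertFlow_le _ _ _).trans hp.2.1)
          · exact Set.indicator_of_notMem hp _

/-- **Registered sub-goal `iterateLambda_bad_null` of `stub_iterateLambda`** (line `Sketch` of the
crux `LambertianContactSwap.LambertianEuler`): for hard spheres of diameter `ε < 1/2` on `𝕋³`, granted
clause 2 of the one-window hypothesis WINDOW at `(V, r, δ)` (a.e. regularity of the Lambertian flow
over one window from a short-time good datum of the shell) and the restricted strong Markov property
MARKOV of the i.i.d. redraws, the survivors of `k` windows are, `vol ⊗ γ^ℕ`-almost surely, regular
over the next window: their instants pass `(k+1)δ` and `Λ_{(k+1)δ}` lies in the hard-sphere domain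
(`measure_iterGoodL_bad_eq_zero`). [cite: GST2013, proof of Prop. 4.1.1 p. 19] -/
theorem iterateLambda_bad_null :
    ∀ {ε : ℝ}, ε < 2⁻¹ → ∀ {N : ℕ} {V r δ : ℝ}, 0 ≤ δ →
      (∀ z : Config N (Fin 3) T3, z ∈ shortGood N ε r δ → configEnergy z ≤ V ^ 2 / 2 →
        ∀ᵐ ξs ∂(lambertNoise (Fin 3)),
          (∃ k, ENNReal.ofReal δ < lambertInstant (Torus.geometry (Fin 3)) ε ξs z k) ∧
          lambertFlow (Torus.geometry (Fin 3)) ε ξs z δ ∈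
            hardSphereDomain (Torus.geometry (Fin 3)) N ε) →
      (∀ (z : Config N (Fin 3) T3) (s : ℝ), 0 ≤ s →
        ∀ {m : ℕ} (rs : Fin m → ℝ), (∀ i, 0 ≤ rs i ∧ rs i ≤ s) →
        ∀ {Q : Set (Fin m → Config N (Fin 3) T3)}, MeasurableSet Q →
        ∀ {H : Config N (Fin 3) T3 × (ℕ → V3) → ℝ≥0∞}, Measurable H →
          ∫⁻ ξs, {ξs : ℕ → V3 |
              (∃ k, ENNReal.ofReal s < lambertInstant (Torus.geometry (Fin 3)) ε ξs z k) ∧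
              (fun i => lambertFlow (Torus.geometry (Fin 3)) ε ξs z (rs i)) ∈ Q}.indicator
              (fun ξs => H (lambertFlow (Torus.geometry (Fin 3)) ε ξs z s,
                fun n => ξs (n + lambertCount (Torus.geometry (Fin 3)) ε ξs z s))) ξs
              ∂(lambertNoise (Fin 3)) =
          ∫⁻ ξs, {ξs : ℕ → V3 |
              (∃ k, ENNReal.ofReal s < lambertInstant (Torus.geometry (Fin 3)) ε ξs z k) ∧
              (fun i => lambertFlow (Torus.geometry (Fin 3)) ε ξs z (rs i)) ∈ Q}.indicator
              (fun ξs => ∫⁻ ηs, H (lambertFlow (Torus.geometry (Fin 3)) ε ξs z s, ηs)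
                ∂(lambertNoise (Fin 3))) ξs
              ∂(lambertNoise (Fin 3))) →
      ∀ k : ℕ, ((volume : Measure (Config N (Fin 3) T3)).prod (lambertNoise (Fin 3)))
        (iterGoodL N ε r δ V k ∩ {p |
          ¬ (∃ j, ENNReal.ofReal (((k : ℝ) + 1) * δ) <
              lambertInstant (Torus.geometry (Fin 3)) ε p.2 p.1 j) ∨
            lambertFlow (Torus.geometry (Fin 3)) ε p.2 p.1 (((k : ℝ) + 1) * δ) ∉
              hardSphereDomain (Torus.geometry (Fin 3)) N ε}) = 0 :=
  fun hε' _ _ _ _ hδ hW2 hM k => measure_iterGoodL_bad_eq_zero hM hW2 hε' hδ k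

end Torus

end Summit.AtomisticToContinuum.HydrodynamicLimit.Theorems.LambertianContactSwapLambertianEulerIterateGood

end
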